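import Summits.Ventures.LatticeQCDFlow.Scaling.MapStarRotation

/-!
HONEST FRAMING: exact (Metropolis-corrected) sampling algorithms for lattice gauge theory; figures
of merit are autocorrelation/cost numbers at stated couplings and volumes; no continuum-physics
claim.

# EntryGraphRotation — THE ROTATION-PATH VARIANCE INEQUALITY ON AN ARBITRARY SWAP GRAPH WITH PER-ENTRY MAPS: IF THE EDGE LIST
# `e : Fin m → (Fin (K+1))²` CONTAINS EVERY HUB EDGE `(0, k+1)` AT LEAST `c` TIMES, WITH TRANSPORTED ONE-SIDED DOMINATION ON THOSE
# ENTRIES ONLY, THEN `Var_{ν⊗}(f) ≤ (1/2 + 3K/p)·V₀(f) + (3/(2pc))·Σ_r T_r(f)` WITH THE SUM OVER ALL ENTRIES (COLD–COLD EDGES, ANY MAPS,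
# INCLUDED AT NO COST) — THE OTHER EDGES ONLY DILUTE (lean-2 GEN-28, ours)

Venture-side (OURS).  Cell `lqcd-flow` (pub-lqcd), unit `pub-lqcd-lean-2-g28`, 2026-08-28.  Chapter N, file 10: `Scaling/MapStarRotation`
(N1) for a general edge list.  Chapter K (`Scaling/SwapGraphDilution`, `Scaling/HubProposalLaw`) priced arbitrary swap graphs with
IDENTITY maps (and level maps by conjugacy): extra edges cost only through the dilution `1/m` of the hub edges' proposal frequency.  The
rotation path of N1 uses the hub entries alone, each through ITS OWN map, and every other entry `r` contributes a non-negative energy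
`T_r(f) = Σ_z min{ν⊗(z), ν⊗(z^{(r)})}(f z − f z^{(r)})²`, so the same inequality holds with the sum over ALL entries — which is what the
Dirichlet form of the graph-swap component delivers (`Scaling/DominatedStarRegimeFreeGap`, `ptGraph_dirichletForm_swap_eq_min`).

## What is proved

* `entryEnergy_nonneg`; **`entryGraph_coldRedraw_le_fiber`** — for a cold level `k+1` whose hub edge `(0, k+1)` is listed `c_k ≥ 1` times
  (entries `r` with `e_r = (0, k+1)`, maps `φ_r`, `p·ν_{k+1}(φ_r u) ≤ ν_0(u)`):
  `c_k·E_{k+1}(f) ≤ c_k·(6/p)·V₀(f) + (3/p)·Σ_{r : e_r = (0,k+1)} T_r(f)`.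
* **`entryGraph_variance_le`** — every hub edge listed `≥ c ≥ 1` times, domination on the hub entries:
  **`Var_{ν⊗}(f) ≤ (1/2 + 3K/p)·V₀(f) + (3/(2pc))·Σ_{r : Fin m} T_r(f)`**, `T_r` the entry energy of the `r`-th edge `(i_r, l_r)` through `φ_r`
  whatever its endpoints.

Reading (no numerics implied): in the quadratic theory a proposal law over ANY set of replica pairs, with any learned maps on the
non-hub pairs, is worth at least its hub sub-law; the next file turns this into the regime-free gap of every such exchange scheme.
NOT CLAIMED: that cold–cold edges help (they may; not here); anything measured.  Literature grade (cell rule): OWN RESULT on N1;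
nothing cited as a fact; no new bib keys.
-/

noncomputable section

open Finset Function
open Literature.Probability.MarkovChains

namespace Summit.Ventures.LatticeQCDFlow.Scaling

variable {S : Type*} [Fintype S] {K m : ℕ} {ν : Fin (K + 1) → S → ℝ}

section Graph
variable (hν : ∀ k u, 0 < ν k u) (hν1 : ∀ k, ∑ u, ν k u = 1) {p : ℝ} (hp : 0 < p)
  (e : Fin m → Fin (K + 1) × Fin (K + 1)) (φ : Fin m → Equiv.Perm S)
  (hpers : ∀ (r : Fin m) (k : Fin K), e r = ((0 : Fin (K + 1)), k.succ) → ∀ u : S, p * ν k.succ (φ r u) ≤ ν 0 u)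
include hν hν1 hp hpers

omit hν1 hp hpers in
/-- The entry energy `T_r(f) = Σ_z min{ν⊗(z), ν⊗(z^{(r)})}(f z − f z^{(r)})²` is non-negative. [ours] -/
theorem entryEnergy_nonneg (f : (Fin (K + 1) → S) → ℝ) (r : Fin m) :
    0 ≤ ∑ z : Fin (K + 1) → S, min (tensorFun ν z) (tensorFun ν (edgeFlowSwap (φ r) (e r).1 (e r).2 z))
      * (f z - f (edgeFlowSwap (φ r) (e r).1 (e r).2 z)) ^ 2 :=
  sum_nonneg fun z _ => mul_nonneg (le_min (tensorFun_pos hν z).le (tensorFun_pos hν _).le) (sq_nonneg _)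

/-- **The cold-redraw energy of level `k+1` through the hub entries of the graph:** if `(0, k+1)` is listed `c_k` times,
`c_k·E_{k+1}(f) ≤ c_k·(6/p)·V₀(f) + (3/p)·Σ_{r : e_r = (0,k+1)} T_r(f)`. [ours] -/
theorem entryGraph_coldRedraw_le_fiber (f : (Fin (K + 1) → S) → ℝ) (k : Fin K) :
    ((univ.filter (fun r : Fin m => e r = ((0 : Fin (K + 1)), k.succ))).card : ℝ)
        * ∑ z : Fin (K + 1) → S, ∑ v, tensorFun ν z * ν k.succ v * (f z - f (update z k.succ v)) ^ 2
      ≤ ((univ.filter (fun r : Fin m => e r = ((0 : Fin (K + 1)), k.succ))).card : ℝ)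
          * (6 / p * ∑ z : Fin (K + 1) → S, ∑ v, tensorFun ν z * ν 0 v * (f z - f (update z 0 v)) ^ 2)
        + 3 / p * ∑ r ∈ univ.filter (fun r : Fin m => e r = ((0 : Fin (K + 1)), k.succ)), ∑ z : Fin (K + 1) → S,
            min (tensorFun ν z) (tensorFun ν (edgeFlowSwap (φ r) (e r).1 (e r).2 z))
              * (f z - f (edgeFlowSwap (φ r) (e r).1 (e r).2 z)) ^ 2 := by
  set F := univ.filter (fun r : Fin m => e r = ((0 : Fin (K + 1)), k.succ)) with hF
  have hr : ∀ r ∈ F, ∑ z : Fin (K + 1) → S, ∑ v, tensorFun ν z * ν k.succ v * (f z - f (update z k.succ v)) ^ 2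
      ≤ 6 / p * (∑ z : Fin (K + 1) → S, ∑ v, tensorFun ν z * ν 0 v * (f z - f (update z 0 v)) ^ 2)
        + 3 / p * ∑ z : Fin (K + 1) → S, min (tensorFun ν z) (tensorFun ν (edgeFlowSwap (φ r) (e r).1 (e r).2 z))
            * (f z - f (edgeFlowSwap (φ r) (e r).1 (e r).2 z)) ^ 2 := by
    intro r hrF
    have her : e r = ((0 : Fin (K + 1)), k.succ) := (Finset.mem_filter.mp hrF).2
    have h := mapStar_coldRedraw_le hν hν1 hp (l := k.succ) (Fin.succ_ne_zero _) (ψ := φ r) (hpers r k her) f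
    rw [her]
    exact h
  have hs := Finset.sum_le_sum hr
  rw [sum_const, nsmul_eq_mul, sum_add_distrib, sum_const, nsmul_eq_mul, ← mul_sum] at hs
  exact hs

/-- **THE ROTATION-PATH VARIANCE INEQUALITY ON AN ARBITRARY SWAP GRAPH WITH PER-ENTRY MAPS.**  Positive probability vectors `ν_k`,
an edge list `e` with maps `φ` such that every hub edge `(0, k+1)` is listed `≥ c ≥ 1` times, transported one-sided domination
`p·ν_{k+1}(φ_r u) ≤ ν_0(u)` on those entries (`0 < p`).  Then for every `f`,
**`Var_{ν⊗}(f) ≤ (1/2 + 3K/p)·V₀(f) + (3/(2pc))·Σ_{r : Fin m} T_r(f)`**, the sum over ALL entries of the list. [ours] -/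
theorem entryGraph_variance_le [DecidableEq S] {c : ℕ} (hc1 : 1 ≤ c)
    (hc : ∀ k : Fin K, c ≤ (univ.filter (fun r : Fin m => e r = ((0 : Fin (K + 1)), k.succ))).card)
    (f : (Fin (K + 1) → S) → ℝ) :
    lawVariance (tensorFun ν) f
      ≤ (1 / 2 + 3 * K / p) * ∑ z : Fin (K + 1) → S, ∑ v, tensorFun ν z * ν 0 v * (f z - f (update z 0 v)) ^ 2
        + 3 / (2 * p * c) * ∑ r : Fin m, ∑ z : Fin (K + 1) → S,
            min (tensorFun ν z) (tensorFun ν (edgeFlowSwap (φ r) (e r).1 (e r).2 z))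
              * (f z - f (edgeFlowSwap (φ r) (e r).1 (e r).2 z)) ^ 2 := by
  have hW0 : ∀ z, 0 ≤ tensorFun ν z := fun z => (tensorFun_pos hν z).le
  set V₀ : ℝ := ∑ z : Fin (K + 1) → S, ∑ v, tensorFun ν z * ν 0 v * (f z - f (update z 0 v)) ^ 2 with hV₀
  set T : Fin m → ℝ := fun r => ∑ z : Fin (K + 1) → S,
    min (tensorFun ν z) (tensorFun ν (edgeFlowSwap (φ r) (e r).1 (e r).2 z))
      * (f z - f (edgeFlowSwap (φ r) (e r).1 (e r).2 z)) ^ 2 with hT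
  set E : Fin K → ℝ := fun k => ∑ z : Fin (K + 1) → S, ∑ v,
    tensorFun ν z * ν k.succ v * (f z - f (update z k.succ v)) ^ 2 with hE
  set Fk : Fin K → Finset (Fin m) := fun k => univ.filter (fun r : Fin m => e r = ((0 : Fin (K + 1)), k.succ)) with hFk
  have hT0 : ∀ r, 0 ≤ T r := fun r => entryEnergy_nonneg hν e φ f r
  have hV0 : 0 ≤ V₀ := sum_nonneg fun z _ => sum_nonneg fun v _ => mul_nonneg (mul_nonneg (hW0 z) (hν _ _).le) (sq_nonneg _)
  have hcpos : (0 : ℝ) < c := Nat.cast_pos.mpr (by omega)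
  -- each cold level through its own hub entries
  have hEk : ∀ k : Fin K, E k ≤ 6 / p * V₀ + 3 / (p * c) * ∑ r ∈ Fk k, T r := by
    intro k
    set ck : ℝ := ((Fk k).card : ℝ) with hck
    have hck1 : (c : ℝ) ≤ ck := by rw [hck]; exact_mod_cast hc k
    have hckpos : 0 < ck := lt_of_lt_of_le hcpos hck1
    have hfib := entryGraph_coldRedraw_le_fiber hν hν1 hp e φ hpers f k
    have h1 : ck * E k ≤ ck * (6 / p * V₀) + 3 / p * ∑ r ∈ Fk k, T r := hfib
    have h2 : E k ≤ 6 / p * V₀ + (3 / p * ∑ r ∈ Fk k, T r) / ck := by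
      have h3 : E k - 6 / p * V₀ ≤ (3 / p * ∑ r ∈ Fk k, T r) / ck := by
        rw [le_div_iff₀ hckpos]
        nlinarith [h1]
      linarith
    have hFk0 : 0 ≤ ∑ r ∈ Fk k, T r := sum_nonneg fun r _ => hT0 r
    have h4 : (3 / p * ∑ r ∈ Fk k, T r) / ck ≤ (3 / p * ∑ r ∈ Fk k, T r) / c :=
      div_le_div_of_nonneg_left (by positivity) hcpos hck1
    calc E k ≤ 6 / p * V₀ + (3 / p * ∑ r ∈ Fk k, T r) / ck := h2
      _ ≤ 6 / p * V₀ + (3 / p * ∑ r ∈ Fk k, T r) / c := by linarith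
      _ = 6 / p * V₀ + 3 / (p * c) * ∑ r ∈ Fk k, T r := by
          field_simp
  -- the hub fibres are pairwise disjoint, so their energies sum to at most the total
  have hdisj : Set.PairwiseDisjoint (↑(univ : Finset (Fin K))) Fk := by
    intro k _ k' _ hkk'
    rw [Function.onFun, Finset.disjoint_left]
    intro r hr hr'
    rw [hFk, Finset.mem_filter] at hr hr'
    have h := hr.2.symm.trans hr'.2
    exact hkk' (Fin.succ_injective _ (Prod.ext_iff.mp h).2)
  have hfiber : ∑ k : Fin K, ∑ r ∈ Fk k, T r ≤ ∑ r : Fin m, T r := by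
    rw [← Finset.sum_biUnion hdisj]
    exact Finset.sum_le_sum_of_subset_of_nonneg (Finset.subset_univ _) fun r _ _ => hT0 r
  have hcold : ∑ k : Fin K, E k ≤ 6 * K / p * V₀ + 3 / (p * c) * ∑ r : Fin m, T r := by
    calc ∑ k : Fin K, E k ≤ ∑ k : Fin K, (6 / p * V₀ + 3 / (p * c) * ∑ r ∈ Fk k, T r) := sum_le_sum fun k _ => hEk k
      _ = 6 * K / p * V₀ + 3 / (p * c) * ∑ k : Fin K, ∑ r ∈ Fk k, T r := by
          rw [sum_add_distrib, sum_const, card_univ, Fintype.card_fin, nsmul_eq_mul, ← mul_sum]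
          ring
      _ ≤ 6 * K / p * V₀ + 3 / (p * c) * ∑ r : Fin m, T r := by
          have := mul_le_mul_of_nonneg_left hfiber (by positivity : (0 : ℝ) ≤ 3 / (p * c))
          linarith
  -- Efron–Stein over the `K+1` coordinates
  have ES := efronStein_tensorFun (ν := ν) (fun k u => (hν k u).le) hν1 f
  rw [Fin.sum_univ_succ] at ES
  have hES : lawVariance (tensorFun ν) f ≤ 1 / 2 * V₀ + 1 / 2 * ∑ k : Fin K, E k := by
    have e1 : ∑ k : Fin K, (1 / 2) * ∑ z : Fin (K + 1) → S, ∑ v,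
        tensorFun ν z * ν k.succ v * (f z - f (update z k.succ v)) ^ 2 = 1 / 2 * ∑ k : Fin K, E k := by
      rw [mul_sum]
    rw [e1] at ES
    exact ES
  calc lawVariance (tensorFun ν) f ≤ 1 / 2 * V₀ + 1 / 2 * ∑ k : Fin K, E k := hES
    _ ≤ 1 / 2 * V₀ + 1 / 2 * (6 * K / p * V₀ + 3 / (p * c) * ∑ r : Fin m, T r) := by linarith [hcold]
    _ = (1 / 2 + 3 * K / p) * V₀ + 3 / (2 * p * c) * ∑ r : Fin m, T r := by
        field_simp
        ring

end Graph

end Summit.Ventures.LatticeQCDFlow.Scaling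

end
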